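import Summits.QuantumFields.QCD.Theses.SpectralDefectExtinction
import Literature.MathematicalPhysics.QuantumFieldTheory.QCDPhaseQuenched
import Literature.MathematicalPhysics.QuantumFieldTheory.SpectralDefectDensity
import Literature.Barriers.QuantumFields.WilsonDeterminantMassSplitting

/-!
# Bridge lemma C toward stub `coareaWegner` of line `Sketch` (skeleton "ResolventCell", gen 2) for
crux `SpectralDefectExtinction.WegnerEstimate` (item stmt-QuantumFields-8966):
the eight one-parameter circles of `SU(3)` used for Crofton slicing

The registered signatures of `stub_currentRigidity` / `stub_coareaWegner` measure the colour current
through a link in the eight directions `X₀, …, X₇` of the explicit basis of `su(3)`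
(three real rotations, three imaginary symmetric, two diagonal).  Each `Xᵢ` is skew-Hermitian with
`Xᵢ³ = −Xᵢ`, so by Rodrigues' formula the one-parameter subgroup it generates is the degree-one
trigonometric polynomial

  `cᵢ(t) = exp(t Xᵢ) = 1 + sin t · Xᵢ + (1 − cos t) · Xᵢ² ∈ SU(3)`.

`coareaWegner_rodriguesCircle` packages, for any such `X`, the curve `c : ℝ → SU(3)` with: the
closed form above (in the shape `δ₀ + cos t δ₁ + sin t δ₂` of bridge lemma B,
`coareaWegner_oneLinkCircle_detShape`), `c 0 = 1`, the group law `c (s + t) = c s · c t` (so that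
`V ↦ V · c(t)` preserves Haar measure and the circles `t ↦ V c(t)` are closed, period `2π`),
continuity, and the entrywise velocity `d/dt|₀ c(t) = X` (the hypothesis `hg` of bridge lemma A,
`coareaWegner_hellmannFeynman`, whose conclusion is then the current `J_{e,Xᵢ}` of the registered
signatures).  `coareaWegner_su3Circles` instantiates it on the eight basis matrices, verbatim as they
appear in the registered signatures.
-/

noncomputable section

namespace Summit.QuantumFields.QCD.Cruxes.WegnerEstimate.ResolventCell

open MeasureTheory
open scoped Matrix BigOperators
open Literature.MathematicalPhysics.QuantumLattice Literature.MathematicalPhysics.QuantumFieldTheory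
  Literature.Probability.LatticeModels
open Matrix
open scoped ComplexOrder

/-- **Rodrigues circles in `SU(3)`.**  For a skew-Hermitian `3 × 3` matrix `X` with `X³ = −X` such
that `det (1 + sin t · X + (1 − cos t) · X²) = 1` for all `t`, the curve
`c(t) = 1 + sin t · X + (1 − cos t) · X²` lies in `SU(3)`, is a continuous `2π`-periodic
one-parameter subgroup (`c 0 = 1`, `c (s + t) = c s · c t`), is a degree-one trigonometric polynomial
`(1 + X²) + cos t · (−X²) + sin t · X`, and has entrywise velocity `X` at `t = 0`. -/
theorem coareaWegner_rodriguesCircle (X : Matrix (Fin 3) (Fin 3) ℂ) (hskew : Xᴴ = -X)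
    (hX3 : X * X * X = -X)
    (hdet : ∀ t : ℝ, ((1 : Matrix (Fin 3) (Fin 3) ℂ) + ((Real.sin t : ℝ) : ℂ) • X +
      ((1 - Real.cos t : ℝ) : ℂ) • (X * X)).det = 1) :
    ∃ c : ℝ → SU3,
      (∀ t, ((c t : SU3) : Matrix (Fin 3) (Fin 3) ℂ) =
        (1 + X * X) + ((Real.cos t : ℝ) : ℂ) • (-(X * X)) + ((Real.sin t : ℝ) : ℂ) • X) ∧
      c 0 = 1 ∧ (∀ s t, c (s + t) = c s * c t) ∧ (∀ t, c (t + 2 * Real.pi) = c t) ∧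
      Continuous c ∧
      (∀ a b : Fin 3,
        HasDerivAt (fun t => ((c t : SU3) : Matrix (Fin 3) (Fin 3) ℂ) a b) (X a b) 0) := by
  -- the matrix family
  set F : ℝ → Matrix (Fin 3) (Fin 3) ℂ := fun t =>
    (1 : Matrix (Fin 3) (Fin 3) ℂ) + ((Real.sin t : ℝ) : ℂ) • X + ((1 - Real.cos t : ℝ) : ℂ) • (X * X)
    with hF
  have hX3' : X * (X * X) = -X := by rw [← Matrix.mul_assoc]; exact hX3
  have hX4 : X * X * (X * X) = -(X * X) := by rw [← Matrix.mul_assoc, hX3, Matrix.neg_mul]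
  have hzero : F 0 = 1 := by simp [hF]
  have hmul : ∀ s t, F (s + t) = F s * F t := by
    intro s t
    simp only [hF, Matrix.add_mul, Matrix.mul_add, Matrix.one_mul, Matrix.mul_one, Matrix.smul_mul,
      Matrix.mul_smul, hX3, hX3', hX4, smul_neg, Real.sin_add, Real.cos_add]
    ext a b
    simp only [Matrix.add_apply, Matrix.smul_apply, Matrix.neg_apply, smul_eq_mul]
    push_cast
    ring
  have hstar : ∀ t, (F t)ᴴ = F (-t) := by
    intro t
    simp only [hF, conjTranspose_add, conjTranspose_smul, conjTranspose_one, conjTranspose_mul, hskew,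
      neg_mul_neg, Real.sin_neg, Real.cos_neg, Complex.star_def, Complex.conj_ofReal,
      Complex.ofReal_neg, neg_smul, smul_neg]
  have hunit : ∀ t, F t ∈ Matrix.unitaryGroup (Fin 3) ℂ := by
    intro t
    rw [Matrix.mem_unitaryGroup_iff', star_eq_conjTranspose, hstar, ← hmul, neg_add_cancel, hzero]
  have hmem : ∀ t, F t ∈ Matrix.specialUnitaryGroup (Fin 3) ℂ := fun t =>
    Matrix.mem_specialUnitaryGroup_iff.2 ⟨hunit t, hdet t⟩
  have hcont : Continuous F :=
    (continuous_const.add ((Complex.continuous_ofReal.comp Real.continuous_sin).smul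
      continuous_const)).add
      ((Complex.continuous_ofReal.comp (continuous_const.sub Real.continuous_cos)).smul continuous_const)
  refine ⟨fun t => ⟨F t, hmem t⟩, ?_, ?_, ?_, ?_, ?_, ?_⟩
  · intro t
    show F t = _
    ext a b
    simp only [hF, Matrix.add_apply, Matrix.smul_apply, Matrix.neg_apply, smul_eq_mul]
    push_cast
    ring
  · exact Subtype.ext hzero
  · intro s t
    exact Subtype.ext (hmul s t)
  · intro t
    apply Subtype.ext
    show F (t + 2 * Real.pi) = F t
    simp only [hF, Real.sin_add_two_pi, Real.cos_add_two_pi]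
  · exact hcont.subtype_mk _
  · intro a b
    show HasDerivAt (fun t => F t a b) (X a b) 0
    simp only [hF, Matrix.add_apply, Matrix.smul_apply, smul_eq_mul]
    have h1 : HasDerivAt (fun t : ℝ => ((Real.sin t : ℝ) : ℂ)) ((Real.cos 0 : ℝ) : ℂ) 0 :=
      (Real.hasDerivAt_sin 0).ofReal_comp
    have h2 : HasDerivAt (fun t : ℝ => ((1 - Real.cos t : ℝ) : ℂ)) ((-(-Real.sin 0) : ℝ) : ℂ) 0 :=
      ((Real.hasDerivAt_cos 0).const_sub 1).ofReal_comp
    refine (((h1.mul_const (X a b)).const_add ((1 : Matrix (Fin 3) (Fin 3) ℂ) a b)).add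
      (h2.mul_const ((X * X) a b))).congr_deriv ?_
    simp

/-- **The eight basis circles of `SU(3)`.**  For each of the eight explicit `su(3)` basis matrices
`Xᵢ` of the registered signatures (`i = 0, 1, 2`: real rotations; `3, 4, 5`: imaginary symmetric;
`6, 7`: diagonal), the one-parameter subgroup `cᵢ(t) = exp(t Xᵢ) = 1 + sin t Xᵢ + (1 − cos t) Xᵢ²` is
a continuous `2π`-periodic subgroup curve in `SU(3)` whose matrix is a degree-one trigonometric
polynomial `δ₀ + cos t δ₁ + sin t δ₂` (input of bridge lemma B) and whose entrywise velocity at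
`t = 0` is `Xᵢ` (input `hg` of bridge lemma A, producing the current `J_{e,Xᵢ}`). -/
theorem coareaWegner_su3Circles (i : Fin 8) :
    ∃ c : ℝ → SU3,
      (∃ δ₀ δ₁ δ₂ : Matrix (Fin 3) (Fin 3) ℂ, ∀ t, ((c t : SU3) : Matrix (Fin 3) (Fin 3) ℂ) =
        δ₀ + ((Real.cos t : ℝ) : ℂ) • δ₁ + ((Real.sin t : ℝ) : ℂ) • δ₂) ∧
      c 0 = 1 ∧ (∀ s t, c (s + t) = c s * c t) ∧ (∀ t, c (t + 2 * Real.pi) = c t) ∧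
      Continuous c ∧
      (∀ a b : Fin 3, HasDerivAt (fun t => ((c t : SU3) : Matrix (Fin 3) (Fin 3) ℂ) a b)
        ((![!![0, 1, 0; -1, 0, 0; 0, 0, 0], !![0, 0, 1; 0, 0, 0; -1, 0, 0],
            !![0, 0, 0; 0, 0, 1; 0, -1, 0], !![0, Complex.I, 0; Complex.I, 0, 0; 0, 0, 0],
            !![0, 0, Complex.I; 0, 0, 0; Complex.I, 0, 0],
            !![0, 0, 0; 0, 0, Complex.I; 0, Complex.I, 0],
            !![Complex.I, 0, 0; 0, -Complex.I, 0; 0, 0, 0],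
            !![0, 0, 0; 0, Complex.I, 0; 0, 0, -Complex.I]] i : Matrix (Fin 3) (Fin 3) ℂ) a b) 0) := by
  have key : ∀ X : Matrix (Fin 3) (Fin 3) ℂ, Xᴴ = -X → X * X * X = -X →
      (∀ t : ℝ, ((1 : Matrix (Fin 3) (Fin 3) ℂ) + ((Real.sin t : ℝ) : ℂ) • X +
        ((1 - Real.cos t : ℝ) : ℂ) • (X * X)).det = 1) →
      ∃ c : ℝ → SU3,
        (∃ δ₀ δ₁ δ₂ : Matrix (Fin 3) (Fin 3) ℂ, ∀ t, ((c t : SU3) : Matrix (Fin 3) (Fin 3) ℂ) =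
          δ₀ + ((Real.cos t : ℝ) : ℂ) • δ₁ + ((Real.sin t : ℝ) : ℂ) • δ₂) ∧
        c 0 = 1 ∧ (∀ s t, c (s + t) = c s * c t) ∧ (∀ t, c (t + 2 * Real.pi) = c t) ∧
        Continuous c ∧
        (∀ a b : Fin 3, HasDerivAt (fun t => ((c t : SU3) : Matrix (Fin 3) (Fin 3) ℂ) a b) (X a b) 0) := by
    intro X h1 h2 h3
    obtain ⟨c, hc, h0, hm, hp, hco, hd⟩ := coareaWegner_rodriguesCircle X h1 h2 h3
    exact ⟨c, ⟨_, _, _, hc⟩, h0, hm, hp, hco, hd⟩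
  fin_cases i
  all_goals
    refine key _ ?_ ?_ ?_
    · ext a b
      fin_cases a <;> fin_cases b <;> simp
    · ext a b
      fin_cases a <;> fin_cases b <;> simp [Matrix.mul_apply, Fin.sum_univ_three]
    · intro t
      have h : Complex.sin (t : ℂ) ^ 2 + Complex.cos (t : ℂ) ^ 2 = 1 := Complex.sin_sq_add_cos_sq _
      simp [Matrix.det_fin_three]
      linear_combination (norm := skip) h
      ring_nf
      try (simp only [Complex.I_sq]; ring)

end Summit.QuantumFields.QCD.Cruxes.WegnerEstimate.ResolventCell

end
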